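import Summits.BirchSwinnertonDyer.BirchSwinnertonDyer.Theorems.CyclotomicUntwistF1OfStabilisedTwist
import Literature.NumberTheory.EllipticCurves.NewformsSpanGamma1Proofs
import Literature.NumberTheory.EllipticCurves.CuspFormTwistGamma1
import Literature.NumberTheory.EllipticCurves.MurtySinhaMultiplicityHeckeProofs
import Literature.NumberTheory.EllipticCurves.NewformsProofs
import HarnessLib

/-!
# The modular statement (★) in `q`-EXPANSION form: C1 `PSUntwistedLFunctionAtThree` from print and the
# modularity on some `Γ₁(L)` of the `q`-series `∑ cₙ qⁿ` with `cₙ − α·c_{n/3} = κ·η̄(n)·aₙ(f_W)`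

Cell `pub/bsd-wall` (D-0145 line `route-BirchSwinnertonDyer-CyclotomicUntwist`), seat `bsd-line-cycu-p3`
(prover seat 3/3, gen 9). THEOREMS ONLY (no definition, no named fact, no `sorry`); helper toward the crux
child C1 = stmt-BirchSwinnertonDyer-27548 (`PSUntwistedLFunctionAtThree`); sequel of this seat's
`CyclotomicUntwistF1OfStabilisedTwist` (C1 ⟸ print + (★)). BSD is not proved by this file; C1 is NOT closed
by it; K1/K2 stay OPEN and WHOLE.

(★) there was a FUNCTIONAL identity on `ℍ`: `G(τ) − ι(α)·G(3τ) = κ·∑_{u mod 9} ι(η(u)) f(τ + u/9)` for a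
weight-`2` cusp form `G` on some `Γ₁(L)`. This file rewrites it as a statement about FOURIER COEFFICIENTS,
using the tree's `Γ₁` newform vocabulary (`liftToGamma1`, `twistRaw1`, `degeneracyMap1`, `cuspCoeff`,
`eq_of_forall_cuspCoeff_eq_gamma1`):

* §1 `degeneracyMap1_apply` — `([α_d]_k g)(τ) = d^{k−1} g(dτ)` (from `coe_degeneracyMap1_eq_slash`,
  `smul_slash_diagGL_apply`); `cuspCoeff_liftToGamma1`; `twistRaw1_liftToGamma1_apply` — the raw twist of
  the lift of `f` by `η⁻¹` is the function `τ ↦ ∑_u η(u) f(τ + u/9)`.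
* §2 `stabilisation_of_cuspCoeff` — if `aₙ(G) − α·𝟙_{3∣n} a_{n/3}(G) = κ·aₙ(h)` for all `n`, `h` the raw
  twist, then `G − α G(3·) = κ h` on `ℍ` (move `G`, `[α₃]G`, `h` to a common level `Γ₁(L′)`, compare
  coefficients with `cuspCoeff_degeneracyMap1`, evaluate); `stabilisation_of_cuspCoeff_explicit` — the same
  with `aₙ(h) = η̄(n)·g(η)·aₙ(f)` (`cuspCoeff_twistRaw1`, `η` primitive).
* §3 `psUntwistedLFunctionAtThree_of_print_of_qExpansion` — **C1 VERBATIM from PRINT (modularity, Carayol's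
  level, GZ86 I.(7.3), GZK) and (★q): on every principal-series row, for a root `α_K` of `X² − a_w(W)X + 3`
  in a coefficient field `K ↪ ℂ₃, ℂ` and a primitive `η_K` mod `9`, SOME weight-`2` cusp form `G` on SOME
  `Γ₁(L)` has `aₙ(G) = ι(α_K)·𝟙_{3∣n}·a_{n/3}(G) + κ·ι(η_K(n))⁻¹·aₙ(f_W)` (`κ ≠ 0`)** — i.e. the `q`-series
  `κ ∑ₙ ι(α_K)^{v₃(n)} ι(η̄_K(n′)) a_{n′}(W) qⁿ` (`n = 3^{v₃(n)} n′`) is modular. In print this is the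
  `3`-primitive part of the oldform expansion of `f_W ⊗ η̄` over its newform `g₀` (level `9M`) with
  `α_K = a₃(g₀)` (Atkin–Li 1978, Thm. 3.1) and `a₃(g₀)² − a_w a₃(g₀) + 3 = 0` (Carayol 1986 (A) at `p = 3`
  with Néron–Ogg–Shafarevich over `ℚ₃(ζ₉)`); neither is proved here.

References: [cite: MazurTateTeitelbaum1986Invent, §I.14] · [cite: Shimura1971, Prop. 3.64] ·
[cite: AtkinLi1978, Thm. 3.1] · [cite: DiamondShurman2005, §5.7–§5.8] · [cite: Carayol1986, Thm. (A)].
-/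

noncomputable section

open scoped MatrixGroups

open CongruenceSubgroup UpperHalfPlane MeasureTheory Set
  Literature.NumberTheory.EllipticCurves Literature.NumberTheory.EllipticCurves.ModularForms
  Literature.NumberTheory.EllipticCurves.Rank1Residual Literature.NumberTheory.IwasawaTheory
  Summit.BirchSwinnertonDyer.BirchSwinnertonDyer.Theses.CyclotomicUntwist

-- single-conjunct summit: `Summit.BirchSwinnertonDyer.BirchSwinnertonDyer.…` repeats the name by design
set_option linter.dupNamespace false
set_option autoImplicit false

namespace Summit.BirchSwinnertonDyer.BirchSwinnertonDyer.Theorems.PSStabilisedTwistQExpansion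

/-! ### §1 Evaluation of degeneracy maps, the lift, and the raw twist -/

section Eval

variable {M : ℕ} [NeZero M] {k : ℤ}

/-- **`([α_d]_k g)(τ) = d^{k−1} · g(dτ)`** for the degeneracy map `degeneracyMap1 M N d k`, `M d ∣ N`
(Diamond–Shurman §5.7). [cite: DiamondShurman2005, §5.7] -/
theorem degeneracyMap1_apply {N d : ℕ} [NeZero N] [NeZero d] (hMd : M * d ∣ N) (g : CuspForm (Gamma1 M) k)
    (τ : ℍ) :
    degeneracyMap1 M N d k g τ =
      (d : ℂ) ^ (k - 1) * g ⟨(d : ℂ) * τ, by simpa using mul_pos (Nat.cast_pos.mpr (NeZero.pos d)) τ.2⟩ := by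
  have hd : 0 < d := NeZero.pos d
  have hd0 : (d : ℂ) ≠ 0 := Nat.cast_ne_zero.mpr hd.ne'
  have h1 := smul_slash_diagGL_apply k d hd ⇑g τ
  rw [← coe_degeneracyMap1_eq_slash M N d k hMd g, Pi.smul_apply, smul_eq_mul] at h1
  have h2 : ((⟨(d : ℝ), Nat.cast_pos.mpr hd⟩ : {x : ℝ // 0 < x}) • τ : ℍ) =
      ⟨(d : ℂ) * τ, by simpa using mul_pos (Nat.cast_pos.mpr hd) τ.2⟩ := by
    apply UpperHalfPlane.ext
    simp [UpperHalfPlane.coe_pos_real_smul]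
  rw [h2] at h1
  rw [← h1, ← mul_assoc, ← zpow_add₀ hd0, show k - 1 + (1 - k) = 0 by ring, zpow_zero, one_mul]

/-- `([α_1]_k g)(τ) = g(τ)`. [cite: DiamondShurman2005, §5.7] -/
theorem degeneracyMap1_one_apply {N : ℕ} [NeZero N] (hM : M * 1 ∣ N) (g : CuspForm (Gamma1 M) k) (τ : ℍ) :
    degeneracyMap1 M N 1 k g τ = g τ := by
  rw [degeneracyMap1_apply hM g τ]
  simp only [Nat.cast_one, one_zpow, one_mul]

/-- The Fourier coefficients of the lift `S_k(Γ₀(M)) → S_k(Γ₁(M))` are those of the form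
(`coe_liftToGamma1`). [folklore] -/
theorem cuspCoeff_liftToGamma1 (f : CuspForm (Gamma0 M) k) (n : ℕ) :
    cuspCoeff (liftToGamma1 M k f) n = cuspCoeff f n := by
  rw [cuspCoeff, cuspCoeff, coe_liftToGamma1_holds M k f]

/-- **The raw twist of the lift of `f` by `η⁻¹` is `τ ↦ ∑_u η(u) f(τ + u/m)`** (`coe_twistRaw1`,
`slash_twistT_apply`, `coe_liftToGamma1`). [cite: Shimura1971, Prop. 3.64] -/
theorem twistRaw1_liftToGamma1_apply {m L : ℕ} [NeZero m] [NeZero L] (hM : M ∣ L) (hm : m ^ 2 ∣ L)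
    (hMm : M * m ∣ L) (f : CuspForm (Gamma0 M) k) (χ : DirichletCharacter ℂ m) (τ : ℍ) :
    twistRaw1 L hM hm hMm (MurtySinha.liftToGamma1_mem_nebentypusSubspace_one M k f) χ⁻¹ τ =
      ∑ u : ZMod m, χ u * f ((((u.val : ℚ) / (m : ℚ) : ℚ) : ℝ) +ᵥ τ) := by
  have h := congrFun (coe_twistRaw1 L hM hm hMm (MurtySinha.liftToGamma1_mem_nebentypusSubspace_one M k f) χ⁻¹) τ
  rw [h, Finset.sum_apply]
  refine Finset.sum_congr rfl fun u _ ↦ ?_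
  rw [Pi.smul_apply, smul_eq_mul, inv_inv, coe_liftToGamma1_holds, slash_twistT_apply]
  rfl

end Eval

/-! ### §2 The stabilisation identity from Fourier coefficients -/

section Stabilisation

variable {N : ℕ} [NeZero N] (f : CuspForm (Gamma0 N) 2)
variable (χ : DirichletCharacter ℂ (3 ^ 2)) (α κ : ℂ)
variable {L : ℕ} [NeZero L] (G : CuspForm (Gamma1 L) 2)

omit [NeZero N] in
/-- `N ∣ N·81`, `9² ∣ N·81`, `N·9 ∣ N·81`: the level of the raw twist by a character mod `9`. [folklore] -/
theorem twistLevel_dvd : N ∣ N * 3 ^ 4 ∧ (3 ^ 2) ^ 2 ∣ N * 3 ^ 4 ∧ N * 3 ^ 2 ∣ N * 3 ^ 4 :=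
  ⟨dvd_mul_right N _, Dvd.intro_left N (by ring), mul_dvd_mul_left N (by norm_num)⟩

/-- **THE STABILISATION IDENTITY FROM FOURIER COEFFICIENTS.** Let `h` be the raw twist of (the lift of)
`f` by `χ⁻¹` at level `N·81`, i.e. `h(τ) = ∑_u χ(u) f(τ + u/9)`. If a weight-`2` cusp form `G` on `Γ₁(L)`
satisfies `aₙ(G) − α·𝟙_{3∣n}·a_{n/3}(G) = κ·aₙ(h)` for every `n`, then `G(τ) − α·G(3τ) = κ·h(τ)` on `ℍ`:
at the common level `L′ = 3L·N·81` the forms `[α_1]G − (α/3)[α_3]G` and `κ[α_1]h` have the same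
coefficients (`cuspCoeff_degeneracyMap1`), hence are equal (`q`-expansion principle), and
`([α_3]G)(τ) = 3G(3τ)`. [cite: DiamondShurman2005, §5.7–§5.8] [cite: Shimura1971, Prop. 3.64] -/
theorem stabilisation_of_cuspCoeff
    (hcoeff : ∀ n : ℕ, cuspCoeff G n - α * (if 3 ∣ n then cuspCoeff G (n / 3) else 0) =
      κ * cuspCoeff (twistRaw1 (N * 3 ^ 4) (twistLevel_dvd (N := N)).1 (twistLevel_dvd (N := N)).2.1
        (twistLevel_dvd (N := N)).2.2 (MurtySinha.liftToGamma1_mem_nebentypusSubspace_one N 2 f) χ⁻¹) n)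
    (τ : ℍ) :
    G τ - α * G (ofComplex (((3 : ℕ) : ℂ) * (τ : ℂ))) =
      κ * ∑ u : ZMod (3 ^ 2), χ u * f ((((u.val : ℚ) / ((3 : ℕ) : ℚ) ^ 2 : ℚ) : ℝ) +ᵥ τ) := by
  set Lt : ℕ := N * 3 ^ 4 with hLt
  set L' : ℕ := L * 3 * Lt with hL'
  haveI : NeZero Lt := ⟨mul_ne_zero (NeZero.ne N) (by norm_num)⟩
  haveI : NeZero L' := ⟨mul_ne_zero (mul_ne_zero (NeZero.ne L) (by norm_num)) (NeZero.ne Lt)⟩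
  set h := twistRaw1 (N * 3 ^ 4) (twistLevel_dvd (N := N)).1 (twistLevel_dvd (N := N)).2.1
    (twistLevel_dvd (N := N)).2.2 (MurtySinha.liftToGamma1_mem_nebentypusSubspace_one N 2 f) χ⁻¹ with hh
  have hL1 : L * 1 ∣ L' := ⟨3 * Lt, by rw [hL']; ring⟩
  have hL3 : L * 3 ∣ L' := ⟨Lt, by rw [hL']⟩
  have hLt1 : Lt * 1 ∣ L' := ⟨L * 3, by rw [hL']; ring⟩
  -- the identity of cusp forms at level `L'`
  have hforms : degeneracyMap1 L L' 1 2 G - (α / 3) • degeneracyMap1 L L' 3 2 G =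
      κ • degeneracyMap1 Lt L' 1 2 h := by
    refine eq_of_forall_cuspCoeff_eq_gamma1 fun n ↦ ?_
    rw [cuspCoeff_sub_gamma1, cuspCoeff_smul_gamma1, cuspCoeff_smul_gamma1, cuspCoeff_degeneracyMap1 hL1,
      cuspCoeff_degeneracyMap1 hL3, cuspCoeff_degeneracyMap1 hLt1]
    simp only [Nat.cast_one, one_mul, one_dvd, if_true, Nat.div_one, Nat.cast_ofNat,
      show ((2 : ℤ) - 1) = 1 by norm_num, zpow_one]
    rw [← hcoeff n]
    ring
  -- evaluate at `τ`
  have hev := congrArg (fun F : CuspForm (Gamma1 L') 2 ↦ (⇑F) τ) hforms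
  simp only [CuspForm.coe_sub, CuspForm.IsGLPos.coe_smul, Pi.sub_apply, Pi.smul_apply, smul_eq_mul] at hev
  rw [degeneracyMap1_one_apply hL1, degeneracyMap1_one_apply hLt1, degeneracyMap1_apply hL3] at hev
  rw [hh, twistRaw1_liftToGamma1_apply] at hev
  have h3τ : (ofComplex (((3 : ℕ) : ℂ) * (τ : ℂ)) : ℍ) =
      ⟨((3 : ℕ) : ℂ) * τ, by simpa using mul_pos (Nat.cast_pos.mpr (NeZero.pos 3)) τ.2⟩ :=
    ofComplex_apply_of_im_pos _
  rw [h3τ]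
  have hcast : ∀ u : ZMod (3 ^ 2), ((((u.val : ℚ) / ((3 : ℕ) : ℚ) ^ 2 : ℚ) : ℝ)) =
      ((((u.val : ℚ) / ((3 ^ 2 : ℕ) : ℚ) : ℚ) : ℝ)) := fun u ↦ by push_cast; ring
  simp_rw [hcast]
  rw [← hev]
  push_cast
  ring

/-- **The same with explicit coefficients**: for `χ` primitive mod `9`, `aₙ(h) = χ⁻¹(n)·g(χ)·aₙ(f)`
(`cuspCoeff_twistRaw1` with the character `χ⁻¹`, `g(χ) = gaussSum χ ψ₉`), so the hypothesis reads
`aₙ(G) − α·𝟙_{3∣n}·a_{n/3}(G) = κ·χ⁻¹(n)·g(χ)·aₙ(f)`. [cite: Shimura1971, Prop. 3.64] -/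
theorem stabilisation_of_cuspCoeff_explicit (hχ : χ.IsPrimitive)
    (hcoeff : ∀ n : ℕ, cuspCoeff G n - α * (if 3 ∣ n then cuspCoeff G (n / 3) else 0) =
      κ * (χ⁻¹ n * gaussSum χ (ZMod.stdAddChar (N := 3 ^ 2)) * cuspCoeff f n))
    (τ : ℍ) :
    G τ - α * G (ofComplex (((3 : ℕ) : ℂ) * (τ : ℂ))) =
      κ * ∑ u : ZMod (3 ^ 2), χ u * f ((((u.val : ℚ) / ((3 : ℕ) : ℚ) ^ 2 : ℚ) : ℝ) +ᵥ τ) := by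
  refine stabilisation_of_cuspCoeff f χ α κ G (fun n ↦ ?_) τ
  rw [hcoeff n, cuspCoeff_twistRaw1 _ _ _ _ _ (isPrimitive_inv hχ), inv_inv, cuspCoeff_liftToGamma1]

end Stabilisation

/-! ### §3 C1 from print and the modularity of the stabilised twisted `q`-series -/

section C1

variable {K : Type*} [Field K] (ιp : K →+* ℂ_[3]) (ι : K →+* ℂ)

include ιp in
/-- **C1 `PSUntwistedLFunctionAtThree` FROM PRINT AND (★q).** PRINT as in
`PSF1OfStabilisedTwist.psUntwistedLFunctionAtThree_of_print_of_stabilisedTwist`. (★q): on every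
principal-series row and for the newform `f` of `W`, there are a primitive `η_K` mod `9`, a root `α_K ∈ K`
of `X² − a_w(W)X + 3`, a level `L`, a weight-`2` cusp form `G` on `Γ₁(L)` and `κ ≠ 0` with
`aₙ(G) − ι(α_K)·𝟙_{3∣n}·a_{n/3}(G) = κ·ι(η_K(n))⁻¹·g(ι∘η_K)·aₙ(f)` for all `n` — the `q`-series
`∑ₙ ι(α_K)^{v₃(n)} ι(η̄_K(n′)) a_{n′}(W) qⁿ` is a cusp form on some `Γ₁(L)`. Then C1 holds VERBATIM.
[cite: MazurTateTeitelbaum1986Invent, §I.14] [cite: AtkinLi1978, Thm. 3.1] [cite: Carayol1986, Thm. (A)]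
[cite: GrossZagier1986, Thm. I.(7.3)] -/
theorem psUntwistedLFunctionAtThree_of_print_of_qExpansion (hmod : nonempty_modularParametrizationData)
    (hlev : ∀ (N : ℕ) [NeZero N], IsNewformOf.level_eq_conductorNorm (N := N))
    (hGZ86 : GrossZagier1986_thm_I_7_3) (hGZK : PublishedInputGZK)
    (hQ : ∀ (W : WeierstrassCurve ℚ) [W.IsElliptic] [W.IsGloballyMinimal], ¬ W.HasCM →
      Summit.BirchSwinnertonDyer.Rank1Residual.Additive.ClassO6 W 3 → Surj W 3 →
      Even (padicValInt 3 W.minimalDiscriminantInt) →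
      W.minimalDiscriminantInt / 3 ^ padicValInt 3 W.minimalDiscriminantInt % 3 = 1 →
      W.analyticRank = 1 →
      ∀ {N : ℕ} [NeZero N] (f : CuspForm (Gamma0 N) 2), IsNewformOf W f →
      ∃ (ηK : DirichletCharacter K (3 ^ 2)) (αK : K) (L : ℕ) (_ : NeZero L) (G : CuspForm (Gamma1 L) 2) (κ : ℂ),
        ηK.IsPrimitive ∧ αK ^ 2 - ((W.psUntwistedTrace : ℤ) : K) * αK + 3 = 0 ∧ κ ≠ 0 ∧
        ∀ n : ℕ, cuspCoeff G n - ι αK * (if 3 ∣ n then cuspCoeff G (n / 3) else 0) =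
          κ * ((ηK.ringHomComp ι)⁻¹ n * gaussSum (ηK.ringHomComp ι) (ZMod.stdAddChar (N := 3 ^ 2)) *
            cuspCoeff f n)) :
    PSUntwistedLFunctionAtThree := by
  refine PSF1OfStabilisedTwist.psUntwistedLFunctionAtThree_of_print_of_stabilisedTwist ιp ι hmod hlev hGZ86
    hGZK fun W _ _ hCM hO6 hsurj hev hsq hr N _ f hf ↦ ?_
  obtain ⟨ηK, αK, L, _, G, κ, hη, hroot, hκ, hcoeff⟩ := hQ W hCM hO6 hsurj hev hsq hr f hf
  refine ⟨ηK, αK, L, inferInstance, G, κ, hη, hroot, hκ, fun τ ↦ ?_⟩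
  have hηC : DirichletCharacter.IsPrimitive (ηK.ringHomComp ι) :=
    (Literature.NumberTheory.EllipticCurves.isPrimitive_ringHomComp_iff ι ηK).mpr hη
  have h := stabilisation_of_cuspCoeff_explicit f (ηK.ringHomComp ι) (ι αK) κ G hηC hcoeff τ
  simpa only [MulChar.ringHomComp_apply] using h

end C1

end Summit.BirchSwinnertonDyer.BirchSwinnertonDyer.Theorems.PSStabilisedTwistQExpansion

end
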